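import Literature.MathematicalPhysics.QuantumFieldTheory.ConformalBootstrap3D.BlockZSeriesABGeneral
import Literature.MathematicalPhysics.QuantumFieldTheory.ConformalBootstrap3D.BlockDiagonalEnclosureAB
import Literature.MathematicalPhysics.QuantumFieldTheory.ConformalBootstrap3D.PointFunctionalTail
import HarnessLib

/-!
# Two-sided enclosure of a mixed-channel block at a real point of the unit square

For a typed block `g` (`IsConformalBlock3D Δ₁₂ Δ₃₄ Δ ℓ g`) with `Δ` strictly above the unitarity bound
(`Δ ≠ 1` if `ℓ = 0`) and a real point `(x, y) ∈ (0,1)²` of the `z`-square, the value is the level series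
`g(x,y) = Σ_n L_n(a,b; x,y)`, `L_n = Σ_j (A_{n,j}(a,b)/λ_ℓ) 𝒫_{Δ+n,j}(x,y)`, `a = −Δ₁₂/2`, `b = Δ₃₄/2`
(`IsConformalBlock3D.hasSum_hrLevelAB_of_lt`). This file turns that series into a TWO-SIDED ENCLOSURE
computable from finitely many closed-form quantities:

* HEAD `H_N(x,y) = Σ_{n ≤ N} L_n(a,b; x,y)` (`hrHeadAB`) — a finite sum, rational in `Δ`;
* TAIL `|g(x,y) − H_N(x,y)| ≤ ½ (t 𝒯_N(a; M) + t⁻¹ 𝒯_N(b; M))` for every `t > 0` and every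
  `M ∈ [max(x,y), 1)` (`IsConformalBlock3D.abs_sub_hrHeadAB_le`), where
  `𝒯_N(c; M) = Σ_{n > N} a_n(c,c) M^{Δ+n}` (`diagTailAB`) is the tail of the reflection-positive DIAGONAL
  series `D(c; M) = Σ_n a_n(c,c) M^{Δ+n}` (`diagSeriesAB`, `a_n(c,c) = Σ_j A_{n,j}(c,c)/λ_ℓ ≥ 0`): the
  weighted AM–GM bound `|A_{n,j}(a,b)| ≤ ½(t A_{n,j}(a,a) + t⁻¹ A_{n,j}(b,b))`
  (`abs_hrCoeffAB_le_weighted`) and the monomial domination `𝒫_{E,j}(x,y) ≤ 𝒫_{E,j}(M,M) = M^E`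
  (`zMono_le_diag`);
* ONE NUMBER PER DIAGONAL TAIL: if `D(c; y') ≤ U` at some `y' ∈ [M, 1)` then
  `𝒯_N(c; M) ≤ (M/y')^{Δ+N+1} (U − S_N(c; y'))` (`diagTailAB_le_of_diagSeriesAB_le`, `S_N` =
  `hrDiagPartialSumAB`), the ratio lemma of `DiagonalSeriesEnclosure`;
* for the reflection-positive ordering `Δ₁₂ = −Δ₃₄` the head is itself a lower bound
  (`IsConformalBlock3D.hrHeadAB_le_of_neg_eq`).

`IsConformalBlock3D.mem_Icc_hrHeadAB` packages `g(x,y) ∈ [H_N − τ, H_N + τ]`,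
`τ = ½(t T_a + t⁻¹ T_b)` for any certified tail bounds `𝒯_N(a; M) ≤ T_a`, `𝒯_N(b; M) ≤ T_b`. This is the
block-value input of a rational-arithmetic reader that must enclose FIXED external operators' blocks at
the nodes of a point functional (e.g. the `ext`-form of a mixed-correlator scan), as opposed to the
sign-only treatment of scanned internal dimensions.

NON-CLAIMS. Soundness lemmas only: no head, tail or diagonal bound is evaluated here and no certificate is
checked; the numbers `N, t, M, y', U, T_a, T_b` are a reader's business. The upper bounds `U` on the
diagonal series are NOT supplied by this file (they are hypotheses, to be discharged from a closed form or
a validated computation elsewhere).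
-/

namespace Literature.MathematicalPhysics.QuantumFieldTheory.ConformalBootstrap3D

open Finset Set Real

noncomputable section

/-! ### §1 The diagonal majorant series and its tail -/

/-- The reflection-positive diagonal series `D(c; y) = Σ_n a_n(c,c) y^{Δ+n}` (= `g^{−2c,2c}_{Δ,ℓ}(y,y)`).
[cite: DolanOsborn2004, §3 eq. (3.11)] -/
def diagSeriesAB (c Δ : ℝ) (ℓ : ℕ) (y : ℝ) : ℝ := ∑' n : ℕ, hrDiagCoeffAB c c Δ ℓ n * y ^ (Δ + n)

/-- Its tail after `N + 1` terms, `𝒯_N(c; y) = Σ_n a_{n+N+1}(c,c) y^{(Δ+N+1)+n}`. [cite: DolanOsborn2004, §3 eq. (3.11)] -/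
def diagTailAB (c Δ : ℝ) (ℓ N : ℕ) (y : ℝ) : ℝ :=
  ∑' n : ℕ, hrDiagCoeffAB c c Δ ℓ (n + (N + 1)) * y ^ ((Δ + N + 1) + (n : ℝ))

/-- Summability of the diagonal series on `(0,1)` strictly above the bound (it is the level series of
`hrBlockAB (−2c) (2c)` on the diagonal). [cite: DolanOsborn2004, §3 eqs. (3.9)–(3.12)] -/
theorem summable_hrDiagCoeffAB_self_rpow (c : ℝ) {Δ : ℝ} {ℓ : ℕ} (hΔ : unitarityBound3D ℓ < Δ) {y : ℝ}
    (hy : y ∈ Ioo (0 : ℝ) 1) : Summable fun n : ℕ => hrDiagCoeffAB c c Δ ℓ n * y ^ (Δ + n) := by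
  have h := (hasSum_hrLevelAB_hrBlockAB (-(2 * c)) (2 * c) (ℓ := ℓ) hΔ hy hy).summable
  have e1 : -(-(2 * c)) / 2 = c := by ring
  have e2 : 2 * c / 2 = c := by ring
  rw [e1, e2] at h
  refine h.congr fun n => ?_
  exact hrLevelAB_diag c c Δ ℓ hy.1 n

/-- Head + tail: `D(c; y) = S_N(c; y) + 𝒯_N(c; y)` (splitting the series of DO §3 eq. (3.11) after
`N + 1` terms). [cite: DolanOsborn2004, §3 eq. (3.11)] -/
theorem diagSeriesAB_eq_partialSum_add_tail (c : ℝ) {Δ : ℝ} {ℓ : ℕ} (hΔ : unitarityBound3D ℓ < Δ) {y : ℝ}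
    (hy : y ∈ Ioo (0 : ℝ) 1) (N : ℕ) :
    diagSeriesAB c Δ ℓ y = hrDiagPartialSumAB c c Δ ℓ N y + diagTailAB c Δ ℓ N y := by
  unfold diagSeriesAB hrDiagPartialSumAB diagTailAB
  exact tsum_rpow_eq_partialSum_add_tail (summable_hrDiagCoeffAB_self_rpow c hΔ hy) N

/-- `𝒯_N(c; y) ≥ 0` (non-negative coefficients of the reflection-positive diagonal series).
[cite: DolanOsborn2004, §3 eq. (3.11)] -/
theorem diagTailAB_nonneg (c : ℝ) {Δ : ℝ} {ℓ : ℕ} (hΔ : unitarityBound3D ℓ < Δ) (N : ℕ) {y : ℝ}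
    (hy : 0 ≤ y) : 0 ≤ diagTailAB c Δ ℓ N y :=
  tsum_nonneg fun _ => mul_nonneg (hrDiagCoeffAB_self_nonneg c hΔ _) (rpow_nonneg hy _)

/-- Summability of the tail of the diagonal series. [cite: DolanOsborn2004, §3 eq. (3.11)] -/
theorem summable_diagTailAB (c : ℝ) {Δ : ℝ} {ℓ : ℕ} (hΔ : unitarityBound3D ℓ < Δ) {y : ℝ}
    (hy : y ∈ Ioo (0 : ℝ) 1) (N : ℕ) :
    Summable fun n : ℕ => hrDiagCoeffAB c c Δ ℓ (n + (N + 1)) * y ^ ((Δ + N + 1) + (n : ℝ)) :=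
  summable_tail_rpow (summable_hrDiagCoeffAB_self_rpow c hΔ hy) N

/-- **One number per diagonal tail.** If `D(c; y') ≤ U` at some `y' ∈ [y, 1)`, then
`𝒯_N(c; y) ≤ (y/y')^{Δ+N+1} (U − S_N(c; y'))` (ratio domination of the tail of DO §3 eq. (3.11),
the truncation step of point evaluation, KPS-D §3.1). [cite: DolanOsborn2004, §3 eq. (3.11)]
[cite: KosPolandSimmonsduffin2014, §3.1] -/
theorem diagTailAB_le_of_diagSeriesAB_le (c : ℝ) {Δ : ℝ} {ℓ : ℕ} (hΔ : unitarityBound3D ℓ < Δ)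
    {y y' U : ℝ} (hy : 0 < y) (hyy' : y ≤ y') (hy'1 : y' < 1) (N : ℕ) (hU : diagSeriesAB c Δ ℓ y' ≤ U) :
    diagTailAB c Δ ℓ N y ≤ (y / y') ^ (Δ + N + 1) * (U - hrDiagPartialSumAB c c Δ ℓ N y') := by
  have hy' : y' ∈ Ioo (0 : ℝ) 1 := ⟨hy.trans_le hyy', hy'1⟩
  have hs' := summable_hrDiagCoeffAB_self_rpow c hΔ hy'
  have h1 := tail_rpow_ratio_le (hrDiagCoeffAB_self_nonneg c hΔ) hy hyy' hs' N
  have h2 : diagTailAB c Δ ℓ N y' = diagSeriesAB c Δ ℓ y' - hrDiagPartialSumAB c c Δ ℓ N y' := by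
    rw [diagSeriesAB_eq_partialSum_add_tail c hΔ hy' N]; ring
  have hfac : 0 ≤ (y / y') ^ (Δ + N + 1) := rpow_nonneg (div_nonneg hy.le hy'.1.le) _
  calc diagTailAB c Δ ℓ N y ≤ (y / y') ^ (Δ + N + 1) * diagTailAB c Δ ℓ N y' := h1
    _ ≤ (y / y') ^ (Δ + N + 1) * (U - hrDiagPartialSumAB c c Δ ℓ N y') :=
        mul_le_mul_of_nonneg_left (by rw [h2]; linarith) hfac


/-! ### §2 Termwise and levelwise domination by the two diagonal series at `M ≥ max(x,y)` -/

/-- `𝒫_{E,j}(x,y) ≤ 𝒫_{E,j}(M,M) = M^E` for `0 < x, y ≤ M`, `j ≤ E`. [cite: DolanOsborn2004, §3 eq. (3.10)] -/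
theorem zMono_le_diag {x y M E : ℝ} {j : ℕ} (hx : 0 < x) (hy : 0 < y) (hxM : x ≤ M) (hyM : y ≤ M)
    (hjE : (j : ℝ) ≤ E) : zMono E j x y ≤ M ^ E := by
  have hM : 0 < M := hx.trans_le hxM
  rw [← zMono_diag E j hM]
  rcases le_total y x with hyx | hxy
  · have h := zMono_le_of_dominated (q := 1) hy hyx hM le_rfl one_pos
      (by nlinarith [mul_le_mul hxM hyM hy.le hM.le]) (by simpa using hxM) hjE
    simpa using h
  · rw [← zMono_symm E j x y]
    have h := zMono_le_of_dominated (q := 1) hx hxy hM le_rfl one_pos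
      (by nlinarith [mul_le_mul hyM hxM hx.le hM.le]) (by simpa using hyM) hjE
    simpa using h

/-- **Termwise weighted domination**: `|T_{n,j}(a,b; x,y)| ≤ ½ (t T_{n,j}(a,a; M,M) + t⁻¹ T_{n,j}(b,b; M,M))`.
[cite: DolanOsborn2004, §3 eq. (3.11)] -/
theorem abs_hrZTermAB_le_weighted_diag {a b Δ : ℝ} {ℓ : ℕ} (hΔ : unitarityBound3D ℓ < Δ)
    (h1 : ℓ = 0 → Δ ≠ 1) {t : ℝ} (ht : 0 < t) {x y M : ℝ} (hx : 0 < x) (hy : 0 < y) (hxM : x ≤ M)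
    (hyM : y ≤ M) (q : ℕ × ℕ) :
    |hrZTermAB a b Δ ℓ x y q| ≤
      (t * hrZTermAB a a Δ ℓ M M q + t⁻¹ * hrZTermAB b b Δ ℓ M M q) / 2 := by
  have hM : 0 < M := hx.trans_le hxM
  have hlam := legendreLam_pos ℓ
  unfold hrZTermAB
  by_cases hj : ℓ + q.1 < q.2
  · simp [hrCoeffAB_eq_zero_of_lt _ _ Δ hj]
  · have hjE : (q.2 : ℝ) ≤ Δ + (q.1 : ℝ) := by
      have hℓ : (ℓ : ℝ) ≤ Δ := (natCast_le_unitarityBound3D ℓ).trans hΔ.le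
      have : (q.2 : ℝ) ≤ (ℓ : ℝ) + (q.1 : ℝ) := by exact_mod_cast (not_lt.mp hj)
      linarith
    have hz := zMono_le_diag (E := Δ + (q.1 : ℝ)) (j := q.2) hx hy hxM hyM hjE
    have hz0 : 0 ≤ zMono (Δ + (q.1 : ℝ)) q.2 x y := zMono_nonneg _ _ hx.le hy.le
    have hA := abs_hrCoeffAB_le_weighted (a := a) (b := b) hΔ h1 ht q.1 q.2
    have hAa := hrCoeffAB_self_nonneg a hΔ q.1 q.2
    have hAb := hrCoeffAB_self_nonneg b hΔ q.1 q.2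
    rw [zMono_diag _ _ hM]
    rw [abs_mul, abs_div, abs_of_pos hlam, abs_of_nonneg hz0]
    have hw : 0 ≤ (t * hrCoeffAB a a Δ ℓ q.1 q.2 + t⁻¹ * hrCoeffAB b b Δ ℓ q.1 q.2) / 2 := by
      have := inv_pos.mpr ht; positivity
    calc |hrCoeffAB a b Δ ℓ q.1 q.2| / legendreLam ℓ * zMono (Δ + (q.1 : ℝ)) q.2 x y
        ≤ (t * hrCoeffAB a a Δ ℓ q.1 q.2 + t⁻¹ * hrCoeffAB b b Δ ℓ q.1 q.2) / 2 / legendreLam ℓ *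
            M ^ (Δ + (q.1 : ℝ)) :=
          mul_le_mul (div_le_div_of_nonneg_right hA hlam.le) hz hz0 (div_nonneg hw hlam.le)
      _ = (t * (hrCoeffAB a a Δ ℓ q.1 q.2 / legendreLam ℓ * M ^ (Δ + (q.1 : ℝ))) +
            t⁻¹ * (hrCoeffAB b b Δ ℓ q.1 q.2 / legendreLam ℓ * M ^ (Δ + (q.1 : ℝ)))) / 2 := by
          field_simp

/-- **Levelwise weighted domination**: `|L_n(a,b; x,y)| ≤ ½ (t a_n(a,a) + t⁻¹ a_n(b,b)) M^{Δ+n}`.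
[cite: DolanOsborn2004, §3 eqs. (3.10)–(3.11)] -/
theorem abs_hrLevelAB_le_weighted_diag {a b Δ : ℝ} {ℓ : ℕ} (hΔ : unitarityBound3D ℓ < Δ)
    (h1 : ℓ = 0 → Δ ≠ 1) {t : ℝ} (ht : 0 < t) {x y M : ℝ} (hx : 0 < x) (hy : 0 < y) (hxM : x ≤ M)
    (hyM : y ≤ M) (n : ℕ) :
    |hrLevelAB a b Δ ℓ x y n| ≤
      (t * (hrDiagCoeffAB a a Δ ℓ n * M ^ (Δ + n)) + t⁻¹ * (hrDiagCoeffAB b b Δ ℓ n * M ^ (Δ + n))) / 2 := by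
  have hM : 0 < M := hx.trans_le hxM
  rw [← hrLevelAB_diag a a Δ ℓ hM n, ← hrLevelAB_diag b b Δ ℓ hM n]
  unfold hrLevelAB
  refine (abs_sum_le_sum_abs _ _).trans ?_
  rw [mul_sum, mul_sum, ← sum_add_distrib, sum_div]
  exact sum_le_sum fun j _ => abs_hrZTermAB_le_weighted_diag hΔ h1 ht hx hy hxM hyM (n, j)

/-! ### §3 Head and the two-sided enclosure of the value -/

/-- The head `H_N(x,y) = Σ_{n ≤ N} L_n(a,b; x,y)` of the level series. [cite: DolanOsborn2004, §3 eq. (3.10)] -/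
def hrHeadAB (a b Δ : ℝ) (ℓ N : ℕ) (x y : ℝ) : ℝ := ∑ n ∈ range (N + 1), hrLevelAB a b Δ ℓ x y n

variable {Δ₁₂ Δ₃₄ Δ : ℝ} {ℓ : ℕ} {g : ℝ → ℝ → ℝ}

/-- **Two-sided tail bound.** For a typed block, `Δ` strictly above the bound (`Δ ≠ 1` if `ℓ = 0`),
`(x,y) ∈ (0,1)²`, `M ∈ [max(x,y), 1)`, `t > 0`:
`|g(x,y) − H_N(x,y)| ≤ ½ (t 𝒯_N(−Δ₁₂/2; M) + t⁻¹ 𝒯_N(Δ₃₄/2; M))`.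
[cite: DolanOsborn2004, §3 eqs. (3.9)–(3.12)] [cite: KosPolandSimmonsduffin2014, §4 eqs. (4.2)–(4.3)] -/
theorem IsConformalBlock3D.abs_sub_hrHeadAB_le (hΔ : unitarityBound3D ℓ < Δ) (h1 : ℓ = 0 → Δ ≠ 1)
    (h : IsConformalBlock3D Δ₁₂ Δ₃₄ Δ ℓ g) {x y M t : ℝ} (hx : x ∈ Ioo (0 : ℝ) 1) (hy : y ∈ Ioo (0 : ℝ) 1)
    (hxM : x ≤ M) (hyM : y ≤ M) (hM1 : M < 1) (ht : 0 < t) (N : ℕ) :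
    |g x y - hrHeadAB (-Δ₁₂ / 2) (Δ₃₄ / 2) Δ ℓ N x y| ≤
      (t * diagTailAB (-Δ₁₂ / 2) Δ ℓ N M + t⁻¹ * diagTailAB (Δ₃₄ / 2) Δ ℓ N M) / 2 := by
  set a := -Δ₁₂ / 2
  set b := Δ₃₄ / 2
  have hM : M ∈ Ioo (0 : ℝ) 1 := ⟨hx.1.trans_le hxM, hM1⟩
  have hlev := h.hasSum_hrLevelAB_of_lt hΔ hx hy
  have hsplit := hlev.summable.sum_add_tsum_nat_add (N + 1)
  have htail : g x y - hrHeadAB a b Δ ℓ N x y = ∑' n, hrLevelAB a b Δ ℓ x y (n + (N + 1)) := by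
    rw [← hlev.tsum_eq, ← hsplit]; unfold hrHeadAB; ring
  rw [htail]
  -- the majorant
  set m : ℕ → ℝ := fun n =>
    (t * (hrDiagCoeffAB a a Δ ℓ (n + (N + 1)) * M ^ ((Δ + N + 1) + (n : ℝ))) +
      t⁻¹ * (hrDiagCoeffAB b b Δ ℓ (n + (N + 1)) * M ^ ((Δ + N + 1) + (n : ℝ)))) / 2 with hm
  have hsa := summable_diagTailAB a hΔ hM N
  have hsb := summable_diagTailAB b hΔ hM N
  have hsm : Summable m := ((hsa.mul_left t).add (hsb.mul_left t⁻¹)).div_const 2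
  have hle : ∀ n, |hrLevelAB a b Δ ℓ x y (n + (N + 1))| ≤ m n := by
    intro n
    have := abs_hrLevelAB_le_weighted_diag (a := a) (b := b) hΔ h1 ht hx.1 hy.1 hxM hyM (n + (N + 1))
    simp only [hm, ← rpow_add_shift]
    exact this
  have hsabs : Summable fun n => |hrLevelAB a b Δ ℓ x y (n + (N + 1))| :=
    hsm.of_nonneg_of_le (fun n => abs_nonneg _) hle
  have hnorm : Summable fun n => ‖hrLevelAB a b Δ ℓ x y (n + (N + 1))‖ := by
    simpa only [Real.norm_eq_abs] using hsabs
  calc |∑' n, hrLevelAB a b Δ ℓ x y (n + (N + 1))|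
      ≤ ∑' n, |hrLevelAB a b Δ ℓ x y (n + (N + 1))| := by
        have := norm_tsum_le_tsum_norm hnorm
        simpa only [Real.norm_eq_abs] using this
    _ ≤ ∑' n, m n := hsabs.tsum_le_tsum hle hsm
    _ = (t * diagTailAB a Δ ℓ N M + t⁻¹ * diagTailAB b Δ ℓ N M) / 2 := by
        simp only [hm, diagTailAB]
        rw [tsum_div_const, (hsa.mul_left t).tsum_add (hsb.mul_left t⁻¹), tsum_mul_left, tsum_mul_left]

/-- **Lower bound by the head for the reflection-positive ordering** `Δ₁₂ = −Δ₃₄` (all levels `≥ 0`).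
[cite: DolanOsborn2004, §3 eq. (3.11)] -/
theorem IsConformalBlock3D.hrHeadAB_le_of_neg_eq (hΔ : unitarityBound3D ℓ < Δ) (hab : Δ₁₂ = -Δ₃₄)
    (h : IsConformalBlock3D Δ₁₂ Δ₃₄ Δ ℓ g) {x y : ℝ} (hx : x ∈ Ioo (0 : ℝ) 1) (hy : y ∈ Ioo (0 : ℝ) 1)
    (N : ℕ) : hrHeadAB (-Δ₁₂ / 2) (Δ₃₄ / 2) Δ ℓ N x y ≤ g x y := by
  have h12 : -Δ₁₂ / 2 = Δ₃₄ / 2 := by rw [hab]; ring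
  have hlev := h.hasSum_hrLevelAB_of_lt hΔ hx hy
  rw [h12] at hlev ⊢
  unfold hrHeadAB
  rw [← hlev.tsum_eq]
  refine hlev.summable.sum_le_tsum (range (N + 1)) fun n _ => ?_
  unfold hrLevelAB
  exact sum_nonneg fun j _ => hrZTermAB_self_nonneg _ hΔ hx.1.le hy.1.le (n, j)

/-- **Packaged enclosure.** With certified tail bounds `𝒯_N(−Δ₁₂/2; M) ≤ T_a`, `𝒯_N(Δ₃₄/2; M) ≤ T_b`
(e.g. from `diagTailAB_le_of_diagSeriesAB_le`) and `τ = ½(t T_a + t⁻¹ T_b)`: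
`g(x,y) ∈ [H_N(x,y) − τ, H_N(x,y) + τ]`. [cite: DolanOsborn2004, §3 eqs. (3.9)–(3.12)] -/
theorem IsConformalBlock3D.mem_Icc_hrHeadAB (hΔ : unitarityBound3D ℓ < Δ) (h1 : ℓ = 0 → Δ ≠ 1)
    (h : IsConformalBlock3D Δ₁₂ Δ₃₄ Δ ℓ g) {x y M t Ta Tb : ℝ} (hx : x ∈ Ioo (0 : ℝ) 1)
    (hy : y ∈ Ioo (0 : ℝ) 1) (hxM : x ≤ M) (hyM : y ≤ M) (hM1 : M < 1) (ht : 0 < t) (N : ℕ)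
    (hTa : diagTailAB (-Δ₁₂ / 2) Δ ℓ N M ≤ Ta) (hTb : diagTailAB (Δ₃₄ / 2) Δ ℓ N M ≤ Tb) :
    g x y ∈ Icc (hrHeadAB (-Δ₁₂ / 2) (Δ₃₄ / 2) Δ ℓ N x y - (t * Ta + t⁻¹ * Tb) / 2)
      (hrHeadAB (-Δ₁₂ / 2) (Δ₃₄ / 2) Δ ℓ N x y + (t * Ta + t⁻¹ * Tb) / 2) := by
  have hτ := h.abs_sub_hrHeadAB_le hΔ h1 hx hy hxM hyM hM1 ht N
  have htinv : 0 < t⁻¹ := inv_pos.mpr ht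
  have hmono : (t * diagTailAB (-Δ₁₂ / 2) Δ ℓ N M + t⁻¹ * diagTailAB (Δ₃₄ / 2) Δ ℓ N M) / 2 ≤
      (t * Ta + t⁻¹ * Tb) / 2 := by
    have := mul_le_mul_of_nonneg_left hTa ht.le
    have := mul_le_mul_of_nonneg_left hTb htinv.le
    linarith
  rw [abs_le] at hτ
  constructor <;> linarith [hτ.1, hτ.2]

end

end Literature.MathematicalPhysics.QuantumFieldTheory.ConformalBootstrap3D
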